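import Literature.NumberTheory.Sieve.DrappeauDispersionR1ppFourBlocks
import Literature.NumberTheory.Sieve.DrappeauDispersionR1ppDecomp
import Literature.NumberTheory.Sieve.DrappeauDispersionR1ppEdge
import Literature.NumberTheory.Sieve.DrappeauDispersionR1ppReduction
import Literature.NumberTheory.Sieve.DivisorBound
import Mathlib.Analysis.SpecialFunctions.Pow.Asymptotics
import HarnessLib

/-!
# Drappeau 2017, §5.5: `ℛ₁''` from Theorem 2.1 — end of the proof of Theorem 5.1

Topic `Literature/NumberTheory/Sieve`, part of the formalisation of §5 of S. Drappeau, Proc. London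
Math. Soc. (3) 114 (2017) 684–732 = arXiv:1504.05549, p. 21: "We can therefore apply Theorem 2.1
… getting … (5.24) … It is crucial to note that … `N³/x ≤ x^{−3η/2}` … Then for small enough `η`
… (5.25)".  We prove the hypothesis `HR1pp'` of `Drappeau2017_theorem51_of_R1pp'` (the bound
`‖ℛ₁''(ξ,λ₁,λ₂)‖ ≤ C N²S² x^{−7κ}`) from the statement of Theorem 2.1 in the corrected form of
Assing–Blomer–Li 2021, Theorem 2.3 (`a = 1`), taken as a HYPOTHESIS `HX` spelled out inline
(the tree has no named fact for it; D-0026), and deduce Theorem 5.1 from `HX`: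

* `R1pp_beta_congr` — `ℛ₁''` only sees `β` on `(N, 2N]`;
* `eventually_large`, `absorption64` — the "x large enough" conditions;
* `R1pp_of_ABL23` — `HX ⟹ HR1pp'` (choice `κ = ν/100`, `ν = min(3η'/4, 1/6)`, `η' = min(η,1/9)`,
  `ε = κ`, `ε₀ = 8δ`, `Λ = 64`; decomposition `norm_R1pp_le_sum_blocks`, per block
  `four_blocks_le_pos/neg`, divisor-bound counting);
* `Drappeau2017_theorem51_of_ABL23` — `HX ⟹ Drappeau2017_theorem51`.

## References

* S. Drappeau, Proc. London Math. Soc. (3) 114 (2017) 684–732, arXiv:1504.05549, §5.5 p. 21,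
  (5.24)–(5.25), Theorem 5.1, Theorem 2.1. [cite: Drappeau2017, §5.5]
* E. Assing, V. Blomer, J. Li, Adv. Math. 393 (2021), Theorem 2.3. [cite: AssingBlomerLi2020, Theorem 2.3]
-/

noncomputable section

open Finset Real Complex Filter
open scoped ArithmeticFunction.Moebius FourierTransform ArithmeticFunction.sigma

namespace Literature.NumberTheory.Sieve

namespace Drappeau2017

open KloostermanQuintilinear

/-! ### `ℛ₁''` only depends on `β` restricted to `(N, 2N]` -/

/-- `ℛ₁''(β) = ℛ₁''(β')` when `β(n₀n) = β'(n₀n)` for `n ∈ B`. [folklore] -/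
theorem R1pp_beta_congr {S Y N M : ℝ} {a₁ a₂ : ℤ} {q₀ n₀ l₁ l₂ : ℕ} {β β' : ℕ → ℂ} {ξ : ℝ} {H : ℕ}
    (h : ∀ n ∈ ((((BFI.dyadic N).filter (fun n : ℕ => IsCoprime (n : ℤ) a₂)).filter (fun n : ℕ => n₀ ∣ n)).image (fun n : ℕ => n / n₀)), β (n₀ * n) = β' (n₀ * n)) :
    ∑ q₁ ∈ ((((((BFI.mRange S Y).filter (fun q : ℕ => 0 < q)).filter (fun q : ℕ => IsCoprime (q : ℤ) (a₁ * a₂))).filter (fun q : ℕ => q₀ ∣ q)).image (fun q : ℕ => q / q₀)).filter (fun q : ℕ => q % (a₂.natAbs * n₀) = l₁)),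
        ∑ q₂ ∈ ((((((BFI.mRange S Y).filter (fun q : ℕ => 0 < q)).filter (fun q : ℕ => IsCoprime (q : ℤ) (a₁ * a₂))).filter (fun q : ℕ => q₀ ∣ q)).image (fun q : ℕ => q / q₀)).filter (fun q : ℕ => q % (a₂.natAbs * n₀) = l₂)),
          ((BFI.bump S Y ((q₀ * q₁ : ℕ) : ℝ) : ℝ) : ℂ) * ((BFI.bump S Y ((q₀ * q₂ : ℕ) : ℝ) : ℝ) : ℂ) *
        ∑ n₁ ∈ ((((BFI.dyadic N).filter (fun n : ℕ => IsCoprime (n : ℤ) a₂)).filter (fun n : ℕ => n₀ ∣ n)).image (fun n : ℕ => n / n₀)), ∑ n₂ ∈ ((((BFI.dyadic N).filter (fun n : ℕ => IsCoprime (n : ℤ) a₂)).filter (fun n : ℕ => n₀ ∣ n)).image (fun n : ℕ => n / n₀)),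
          (if (Nat.Coprime q₁ q₂ ∧ Nat.Coprime n₁ n₂) then (1 : ℂ) else 0) *
            (β (n₀ * n₁) * starRingEnd ℂ (β (n₀ * n₂))) *
          (if ((n₀ * n₁).Coprime (q₀ * q₁) ∧ (n₀ * n₂).Coprime (q₀ * q₂) ∧ n₁ ≡ n₂ [MOD q₀]) then
              ∑ h ∈ Finset.Icc (-(H : ℤ)) H,
                (if ((Nat.lcm (q₀ * q₁) (q₀ * q₂) : ℕ) : ℤ) ∣ h then 0 else
                  (𝐞 (-(ξ * h)) : ℂ) * BFI.bumpC 1 (1 / 2) ((Nat.lcm (q₀ * q₁) (q₀ * q₂) : ℕ) * ξ / M) *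
                    ((𝐞 ((h : ℝ) * a₁ * ((((n₁ : ℤ) - n₂) / q₀ : ℤ)) *
                    ((((((q₁ : ℤ) * a₂ * n₀ * n₂ : ℤ) : ZMod (n₁ * q₂))⁻¹).val : ℕ) : ℝ) /
                      ((n₁ : ℝ) * q₂)) : ℂ) *
                      (𝐞 (-((h : ℝ) * a₁ *
                    ((((((q₀ : ℤ) * l₁ * l₂ * n₁ : ℤ) : ZMod (a₂.natAbs * n₀))⁻¹).val : ℕ) : ℝ) /
                      ((a₂ : ℝ) * n₀))) : ℂ)))
            else 0) =
    ∑ q₁ ∈ ((((((BFI.mRange S Y).filter (fun q : ℕ => 0 < q)).filter (fun q : ℕ => IsCoprime (q : ℤ) (a₁ * a₂))).filter (fun q : ℕ => q₀ ∣ q)).image (fun q : ℕ => q / q₀)).filter (fun q : ℕ => q % (a₂.natAbs * n₀) = l₁)),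
        ∑ q₂ ∈ ((((((BFI.mRange S Y).filter (fun q : ℕ => 0 < q)).filter (fun q : ℕ => IsCoprime (q : ℤ) (a₁ * a₂))).filter (fun q : ℕ => q₀ ∣ q)).image (fun q : ℕ => q / q₀)).filter (fun q : ℕ => q % (a₂.natAbs * n₀) = l₂)),
          ((BFI.bump S Y ((q₀ * q₁ : ℕ) : ℝ) : ℝ) : ℂ) * ((BFI.bump S Y ((q₀ * q₂ : ℕ) : ℝ) : ℝ) : ℂ) *
        ∑ n₁ ∈ ((((BFI.dyadic N).filter (fun n : ℕ => IsCoprime (n : ℤ) a₂)).filter (fun n : ℕ => n₀ ∣ n)).image (fun n : ℕ => n / n₀)), ∑ n₂ ∈ ((((BFI.dyadic N).filter (fun n : ℕ => IsCoprime (n : ℤ) a₂)).filter (fun n : ℕ => n₀ ∣ n)).image (fun n : ℕ => n / n₀)),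
          (if (Nat.Coprime q₁ q₂ ∧ Nat.Coprime n₁ n₂) then (1 : ℂ) else 0) *
            (β' (n₀ * n₁) * starRingEnd ℂ (β' (n₀ * n₂))) *
          (if ((n₀ * n₁).Coprime (q₀ * q₁) ∧ (n₀ * n₂).Coprime (q₀ * q₂) ∧ n₁ ≡ n₂ [MOD q₀]) then
              ∑ h ∈ Finset.Icc (-(H : ℤ)) H,
                (if ((Nat.lcm (q₀ * q₁) (q₀ * q₂) : ℕ) : ℤ) ∣ h then 0 else
                  (𝐞 (-(ξ * h)) : ℂ) * BFI.bumpC 1 (1 / 2) ((Nat.lcm (q₀ * q₁) (q₀ * q₂) : ℕ) * ξ / M) *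
                    ((𝐞 ((h : ℝ) * a₁ * ((((n₁ : ℤ) - n₂) / q₀ : ℤ)) *
                    ((((((q₁ : ℤ) * a₂ * n₀ * n₂ : ℤ) : ZMod (n₁ * q₂))⁻¹).val : ℕ) : ℝ) /
                      ((n₁ : ℝ) * q₂)) : ℂ) *
                      (𝐞 (-((h : ℝ) * a₁ *
                    ((((((q₀ : ℤ) * l₁ * l₂ * n₁ : ℤ) : ZMod (a₂.natAbs * n₀))⁻¹).val : ℕ) : ℝ) /
                      ((a₂ : ℝ) * n₀))) : ℂ)))
            else 0) := by
  refine Finset.sum_congr rfl fun q₁ _ => Finset.sum_congr rfl fun q₂ _ => ?_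
  congr 1
  refine Finset.sum_congr rfl fun n₁ hn₁ => Finset.sum_congr rfl fun n₂ hn₂ => ?_
  rw [h n₁ hn₁, h n₂ hn₂]

/-! ### "x large enough" -/

/-- The "x large enough" conditions of §5.5. [cite: Drappeau2017, §5.5 p. 21] -/
theorem eventually_large {η κ δ ε₁ : ℝ} (hκη : κ < η) (hκ : 0 < κ) (hsum : 7 / 20 + ε₁ + κ < 1)
    (hκ12 : κ < 1 / 2) (hκδ : κ + δ < 1 / 4) :
    ∃ x₀ : ℝ, ∀ x, x₀ ≤ x → (2 : ℝ) ≤ x ∧ 2 * x ^ κ ≤ x ^ η ∧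
      64 * x ^ (7 / 20 + ε₁ + κ) ≤ x ^ (1 : ℝ) ∧ 32 / 9 * x ^ κ ≤ x ^ (1 / 2 : ℝ) ∧
      40 / 29 * x ^ (κ + δ) ≤ x ^ (1 / 4 : ℝ) ∧ 48 * Real.log x + 312 ≤ x ^ (κ / 4) := by
  -- `c x^a ≤ x^b` eventually, for `a < b` (also a lemma on the Summits side; kept local here)
  have ev : ∀ (c : ℝ) {a b : ℝ}, a < b → ∀ᶠ x : ℝ in atTop, c * x ^ a ≤ x ^ b := by
    intro c a b hab
    have ht : Tendsto (fun x : ℝ => x ^ (b - a)) atTop atTop := tendsto_rpow_atTop (by linarith)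
    filter_upwards [ht.eventually_ge_atTop c, eventually_ge_atTop (1 : ℝ)] with x hx hx1
    have hx0 : 0 < x := by linarith
    calc c * x ^ a ≤ x ^ (b - a) * x ^ a := by gcongr
      _ = x ^ b := by rw [← Real.rpow_add hx0]; ring_nf
  have hκ4 : 0 < κ / 4 := by linarith
  have h6 : ∀ᶠ x : ℝ in atTop, 48 * Real.log x + 312 ≤ x ^ (κ / 4) := by
    have h1 := (isLittleO_log_rpow_atTop hκ4).bound (by norm_num : (0 : ℝ) < 1 / 96)
    have h2 := (tendsto_rpow_atTop hκ4).eventually_ge_atTop (624 : ℝ)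
    filter_upwards [h1, h2, eventually_ge_atTop (1 : ℝ)] with x hx1 hx2 hx3
    have hl : Real.log x ≤ 1 / 96 * x ^ (κ / 4) := by
      have := hx1
      rw [Real.norm_eq_abs, Real.norm_eq_abs, abs_of_nonneg (Real.log_nonneg hx3),
        abs_of_nonneg (Real.rpow_nonneg (by linarith) _)] at this
      exact this
    linarith
  obtain ⟨x₀, hx₀⟩ := Filter.eventually_atTop.1 ((eventually_ge_atTop (2 : ℝ)).and
    ((ev 2 hκη).and ((ev 64 hsum).and ((ev (32 / 9) hκ12).and ((ev (40 / 29) hκδ).and h6)))))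
  exact ⟨x₀, fun x hx => hx₀ x hx⟩

/-- **Absorption of the derivative constants**: on `t ≥ (S−Y)/(q₀δ₁δ₂)`,
`(2S+Y)/Y + 32 ≤ 64 t^{8δ}`. [cite: Drappeau2017, §5.5 p. 20–21] -/
theorem absorption64 {x δ κ S Y u : ℝ} (hx : 1 ≤ x) (hδ : 0 ≤ δ) (hκ : 0 ≤ κ)
    (h16 : 8 * κ + 16 * δ ≤ 1) (hS : x ^ (1 / 4 : ℝ) ≤ S) (hY : S * x ^ (-δ) ≤ Y)
    (hYS : Y ≤ S / 4) (hY0 : 0 < Y) (hu0 : 0 < u) (hu : u ≤ x ^ κ * (x ^ δ * x ^ δ)) :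
    ∀ t : ℝ, (S - Y) / u ≤ t → (2 * S + Y) / Y + 29 + 3 ≤ 64 * t ^ (8 * δ) := by
  intro t ht
  have hx0 : 0 < x := by linarith
  have hx14 : (1 : ℝ) ≤ x ^ (1 / 4 : ℝ) := Real.one_le_rpow hx (by norm_num)
  have hS0 : 0 < S := by linarith
  have hxδ : (1 : ℝ) ≤ x ^ δ := Real.one_le_rpow hx hδ
  -- `S/Y ≤ x^δ`
  have hSY : S / Y ≤ x ^ δ := by
    rw [div_le_iff₀ hY0]
    have h1 : S * x ^ (-δ) * x ^ δ ≤ Y * x ^ δ := by gcongr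
    rw [mul_assoc, ← Real.rpow_add hx0, neg_add_cancel, Real.rpow_zero, mul_one] at h1
    linarith
  have hL : (2 * S + Y) / Y + 29 + 3 = 2 * (S / Y) + 33 := by field_simp; ring
  rw [hL]
  -- `t ≥ (3/4) x^{1/4-κ-2δ}`
  set a : ℝ := 1 / 4 - κ - 2 * δ with ha
  have hxa : x ^ (1 / 4 : ℝ) = x ^ a * (x ^ κ * (x ^ δ * x ^ δ)) := by
    rw [← Real.rpow_add hx0, ← Real.rpow_add hx0, ← Real.rpow_add hx0]; rw [ha]; ring_nf
  have ht0 : 3 / 4 * x ^ a ≤ t := by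
    refine le_trans ?_ ht
    rw [le_div_iff₀ hu0]
    have h1 : 3 / 4 * x ^ a * u ≤ 3 / 4 * x ^ a * (x ^ κ * (x ^ δ * x ^ δ)) := by gcongr
    have h2 : 3 / 4 * x ^ a * (x ^ κ * (x ^ δ * x ^ δ)) = 3 / 4 * x ^ (1 / 4 : ℝ) := by
      rw [hxa]; ring
    linarith [h1, h2]
  have hxapos : 0 < x ^ a := Real.rpow_pos_of_pos hx0 a
  have ht8 : (3 / 4 * x ^ a) ^ (8 * δ) ≤ t ^ (8 * δ) :=
    Real.rpow_le_rpow (by positivity) ht0 (by positivity)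
  have hsplit : (3 / 4 * x ^ a) ^ (8 * δ) = (3 / 4 : ℝ) ^ (8 * δ) * x ^ (a * (8 * δ)) := by
    rw [Real.mul_rpow (by norm_num) hxapos.le, ← Real.rpow_mul hx0.le]
  have h34 : (3 / 4 : ℝ) ≤ (3 / 4 : ℝ) ^ (8 * δ) := by
    calc (3 / 4 : ℝ) = (3 / 4 : ℝ) ^ (1 : ℝ) := (Real.rpow_one _).symm
      _ ≤ (3 / 4 : ℝ) ^ (8 * δ) :=
          Real.rpow_le_rpow_of_exponent_ge (by norm_num) (by norm_num) (by linarith)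
  have hxaδ : x ^ δ ≤ x ^ (a * (8 * δ)) := by
    refine Real.rpow_le_rpow_of_exponent_le hx ?_
    rw [ha]; nlinarith
  have hmain : 3 / 4 * x ^ δ ≤ t ^ (8 * δ) := by
    calc 3 / 4 * x ^ δ ≤ (3 / 4 : ℝ) ^ (8 * δ) * x ^ (a * (8 * δ)) := by gcongr
      _ = (3 / 4 * x ^ a) ^ (8 * δ) := hsplit.symm
      _ ≤ _ := ht8
  nlinarith [hSY, hmain, hxδ]


/-! ### The main theorem -/

set_option maxHeartbeats 4000000 in
/-- **`ℛ₁''` from Theorem 2.1** ((5.24)–(5.25)): the hypothesis `HR1pp'` of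
`Drappeau2017_theorem51_of_R1pp'`, from the statement of [Drappeau2017, Theorem 2.1] in the
corrected form [AssingBlomerLi2020, Theorem 2.3] (`a = 1`), taken as the hypothesis `HX`.
[cite: Drappeau2017, §5.5 p. 21, (5.24)–(5.25)] -/
theorem R1pp_of_ABL23
    (HX :   ∃ B : ℝ, 0 < B ∧ ∃ ε₀max : ℝ, 0 < ε₀max ∧ ∀ ε : ℝ, 0 < ε → ∀ ε₀ : ℝ, 0 < ε₀ → ε₀ ≤ ε₀max →
  ∀ Kν : (Fin 5 → ℕ) → ℝ, ∃ A : ℝ, 0 < A ∧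
  ∀ C D N R S : ℝ, 1 ≤ C → 1 ≤ D → 1 ≤ N → 1 ≤ R → 1 ≤ S →
  ∀ q c₀ d₀ : ℕ, 0 < q → Nat.Coprime (c₀ * d₀) q →
  ∀ b : ℕ → ℕ → ℕ → ℂ,
    (∀ n r s : ℕ, b n r s ≠ 0 →
      (0 < n ∧ (n : ℝ) ≤ N ∧ R < r ∧ (r : ℝ) ≤ 2 * R ∧ S < s ∧ (s : ℝ) ≤ 2 * S)) →
  ∀ g : ℝ → ℝ → ℝ → ℝ → ℝ → ℂ,
    ContDiff ℝ (⊤ : ℕ∞) (fun p : Fin 5 → ℝ => g (p 0) (p 1) (p 2) (p 3) (p 4)) →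
    HasCompactSupport (fun p : Fin 5 → ℝ => g (p 0) (p 1) (p 2) (p 3) (p 4)) →
    (∀ c d n r s : ℝ, g c d n r s ≠ 0 →
      (C < c ∧ c ≤ 2 * C ∧ D < d ∧ d ≤ 2 * D ∧ 0 < n ∧ 0 < r ∧ 0 < s)) →
    (∀ ν : Fin 5 → ℕ, ∀ c d n r s : ℝ, 0 < c → 0 < d → 0 < n → 0 < r → 0 < s →
      ‖mixedDeriv ν g c d n r s‖ ≤ Kν ν *
        (c ^ (-(ν 0 : ℝ)) * d ^ (-(ν 1 : ℝ)) * n ^ (-(ν 2 : ℝ)) * r ^ (-(ν 3 : ℝ)) *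
          s ^ (-(ν 4 : ℝ))) ^ (1 - ε₀)) →
    ‖∑ c ∈ Icc 1 ⌊2 * C⌋₊, ∑ d ∈ Icc 1 ⌊2 * D⌋₊, ∑ n ∈ Icc 1 ⌊N⌋₊, ∑ r ∈ Icc 1 ⌊2 * R⌋₊,
        ∑ s ∈ Icc 1 ⌊2 * S⌋₊,
        (if (c ≡ c₀ [MOD q] ∧ d ≡ d₀ [MOD q] ∧ Nat.Coprime (q * r * d) (s * c)) then
          b n r s * g c d n r s *
            (𝐞 ((n : ℝ) * ((((r * d : ℕ) : ZMod (s * c))⁻¹).val : ℝ) / ((s : ℝ) * c)) : ℂ)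
        else 0)‖ ≤
      A * ((q : ℝ) * C * D * N * R * S) ^ (ε + B * ε₀) * (q : ℝ) ^ (3 / 2 : ℝ) *
        Real.sqrt
          ((q : ℝ) ^ 2 * (C * S * (R * S + N) * (C + R * D) + S * N * R) *
              (∑ n ∈ Icc 1 ⌊N⌋₊, ∑ r ∈ Icc 1 ⌊2 * R⌋₊, ∑ s ∈ Icc 1 ⌊2 * S⌋₊, ‖b n r s‖ ^ 2) +
            (q : ℝ) * (C ^ 2 * D * S * Real.sqrt (R * (R * S + N)) + D ^ 2 * N * R) *
              (∑ n ∈ Icc 1 ⌊N⌋₊, ∑ r ∈ Icc 1 ⌊2 * R⌋₊, ∑ s ∈ Icc 1 ⌊2 * S⌋₊, ‖b n r s‖ ^ 2))) :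
    ∀ η : ℝ, 0 < η → ∃ ε₁ κ δ : ℝ, 0 < ε₁ ∧ ε₁ ≤ 1 / 25 ∧ 0 < κ ∧ 0 < δ ∧
      ∀ Aτ : ℝ, 0 ≤ Aτ → ∃ C x₀ : ℝ, ∀ x : ℝ, x₀ ≤ x →
      ∀ M N S Rd Y : ℝ, M * N = x → x ^ η ≤ N → N ≤ S ^ (2 / 3 - η) → x ^ (1 / 4 : ℝ) ≤ S →
        S ≤ x ^ (1 / 2 + δ) → 1 ≤ Rd → Rd ≤ x ^ δ → S * x ^ (-δ) ≤ Y → Y ≤ S / 4 →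
      ∀ a₁ a₂ : ℤ, a₁ ≠ 0 → a₂ ≠ 0 → (|a₁| : ℝ) ≤ x ^ δ → (|a₂| : ℝ) ≤ x ^ δ →
      ∀ β : ℕ → ℂ, (∀ n, ‖β n‖ ≤ (σ 0 n : ℝ) ^ Aτ) → (∀ n, ¬Squarefree n → β n = 0) →
      ∀ q₀ n₀ : ℕ, 0 < q₀ → (q₀ : ℝ) ≤ x ^ κ → 0 < n₀ → (n₀ : ℝ) ≤ x ^ κ → Nat.Coprime q₀ n₀ →
        IsCoprime (q₀ : ℤ) (a₁ * a₂) → IsCoprime (n₀ : ℤ) a₂ →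
      ∀ ξ : ℝ, ∀ l₁ l₂ : ℕ,
        ‖∑ q₁ ∈ (((((BFI.mRange S Y).filter (fun q : ℕ => 0 < q)).filter
              (fun q : ℕ => IsCoprime (q : ℤ) (a₁ * a₂))).filter (fun q : ℕ => q₀ ∣ q)).image (fun q : ℕ => q / q₀)).filter (fun q : ℕ => q % (a₂.natAbs * n₀) = l₁),
          ∑ q₂ ∈ (((((BFI.mRange S Y).filter (fun q : ℕ => 0 < q)).filter
              (fun q : ℕ => IsCoprime (q : ℤ) (a₁ * a₂))).filter (fun q : ℕ => q₀ ∣ q)).image (fun q : ℕ => q / q₀)).filter (fun q : ℕ => q % (a₂.natAbs * n₀) = l₂),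
          ((BFI.bump S Y ((q₀ * q₁ : ℕ) : ℝ) : ℝ) : ℂ) * ((BFI.bump S Y ((q₀ * q₂ : ℕ) : ℝ) : ℝ) : ℂ) *
        ∑ n₁ ∈ (((BFI.dyadic N).filter (fun n : ℕ => IsCoprime (n : ℤ) a₂)).filter (fun n : ℕ => n₀ ∣ n)).image (fun n : ℕ => n / n₀),
          ∑ n₂ ∈ (((BFI.dyadic N).filter (fun n : ℕ => IsCoprime (n : ℤ) a₂)).filter (fun n : ℕ => n₀ ∣ n)).image (fun n : ℕ => n / n₀),
          (if (Nat.Coprime q₁ q₂ ∧ Nat.Coprime n₁ n₂) then (1 : ℂ) else 0) *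
            (β (n₀ * n₁) * starRingEnd ℂ (β (n₀ * n₂))) *
          (if ((n₀ * n₁).Coprime (q₀ * q₁) ∧ (n₀ * n₂).Coprime (q₀ * q₂) ∧ n₁ ≡ n₂ [MOD q₀]) then
              ∑ h ∈ Finset.Icc (-(⌈(3 * S) ^ 2 * x ^ ε₁ / M⌉₊ : ℤ)) ⌈(3 * S) ^ 2 * x ^ ε₁ / M⌉₊,
                (if ((Nat.lcm (q₀ * q₁) (q₀ * q₂) : ℕ) : ℤ) ∣ h then 0 else
                  (𝐞 (-(ξ * h)) : ℂ) * BFI.bumpC 1 (1 / 2) ((Nat.lcm (q₀ * q₁) (q₀ * q₂) : ℕ) * ξ / M) *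
                    ((𝐞 ((h : ℝ) * a₁ * ((((n₁ : ℤ) - n₂) / q₀ : ℤ)) *
                        ((((((q₁ : ℤ) * a₂ * n₀ * n₂ : ℤ) : ZMod (n₁ * q₂))⁻¹).val : ℕ) : ℝ) /
                          ((n₁ : ℝ) * q₂)) : ℂ) *
                      (𝐞 (-((h : ℝ) * a₁ *
                        ((((((q₀ : ℤ) * l₁ * l₂ * n₁ : ℤ) : ZMod (a₂.natAbs * n₀))⁻¹).val : ℕ) : ℝ) /
                          ((a₂ : ℝ) * n₀))) : ℂ)))
            else 0)‖ ≤
          C * N ^ 2 * S ^ 2 * x ^ (-7 * κ) := by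
  intro η hη
  obtain ⟨Bc, hBc, ε₀max, hε₀max, hmain⟩ := HX
  ----------------------------------------------------------------
  -- exponents
  ----------------------------------------------------------------
  set η' : ℝ := min η (1 / 9) with hη'def
  have hη'0 : 0 < η' := lt_min hη (by norm_num)
  have hη'1 : η' ≤ 1 / 9 := min_le_right _ _
  have hη'η : η' ≤ η := min_le_left _ _
  set ν : ℝ := min (3 * η' / 4) (1 / 6) with hνdef
  have hν0 : 0 < ν := lt_min (by linarith) (by norm_num)
  have hν6 : ν ≤ 1 / 6 := min_le_right _ _
  set κ : ℝ := ν / 100 with hκdef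
  have hκ0 : 0 < κ := by positivity
  have hκs : κ ≤ 1 / 600 := by rw [hκdef]; linarith only [hν6]
  have hκη : κ < η := by
    have : ν ≤ 3 * η' / 4 := min_le_left _ _
    rw [hκdef]; linarith only [this, hη'η, hη]
  set δ : ℝ := min κ (ε₀max / 2) / (8 * (1 + Bc)) with hδdef
  have hmin0 : 0 < min κ (ε₀max / 2) := lt_min hκ0 (by linarith only [hε₀max])
  have hδ0 : 0 < δ := by positivity
  have h1B : (1 : ℝ) ≤ 1 + Bc := by linarith only [hBc]
  have hδκ : δ ≤ κ / 8 := by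
    rw [hδdef, div_le_div_iff₀ (by positivity) (by norm_num)]
    nlinarith only [min_le_left κ (ε₀max / 2), hmin0, hBc, hκ0]
  have h8δ : 8 * δ ≤ ε₀max := by
    rw [hδdef]
    rw [show 8 * (min κ (ε₀max / 2) / (8 * (1 + Bc))) = min κ (ε₀max / 2) / (1 + Bc) by
      field_simp]
    rw [div_le_iff₀ (by positivity)]
    nlinarith only [min_le_right κ (ε₀max / 2), hmin0, hε₀max, hBc]
  have hBδ : Bc * (8 * δ) ≤ κ := by
    rw [hδdef]
    rw [show Bc * (8 * (min κ (ε₀max / 2) / (8 * (1 + Bc)))) = min κ (ε₀max / 2) * (Bc / (1 + Bc)) by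
      field_simp]
    have h1 : Bc / (1 + Bc) ≤ 1 := by rw [div_le_one (by positivity)]; linarith only [hBc]
    calc min κ (ε₀max / 2) * (Bc / (1 + Bc)) ≤ min κ (ε₀max / 2) * 1 := by gcongr
      _ ≤ κ := by rw [mul_one]; exact min_le_left _ _
  set ε₁ : ℝ := min (1 / 25) κ with hε₁def
  have hε₁0 : 0 < ε₁ := lt_min (by norm_num) hκ0
  have hε₁κ : ε₁ ≤ κ := min_le_right _ _
  refine ⟨ε₁, κ, δ, hε₁0, min_le_left _ _, hκ0, hδ0, ?_⟩
  intro Aτ hAτ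
  ----------------------------------------------------------------
  -- constants
  ----------------------------------------------------------------
  obtain ⟨A, hA, hcrux⟩ := hmain κ hκ0 (8 * δ) (by positivity) h8δ (KnuFamily 64)
  obtain ⟨Cd, hCd1, hCd⟩ := exists_card_divisors_le_mul_rpow (ε := 1 / 8) (by norm_num)
  obtain ⟨Cσ, hCσ1, hCσ⟩ := exists_sigma_zero_le_mul_rpow (ε := κ / (8 * (Aτ + 1))) (by positivity)
  obtain ⟨x₁, hx₁⟩ := eventually_large (δ := δ) (ε₁ := ε₁) hκη hκ0 (by linarith only [hε₁κ, hκs])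
    (by linarith only [hκs]) (by linarith only [hδκ, hκs, hκ0])
  refine ⟨169632 * Real.sqrt (9 / 5) * A * (2 * (Cσ ^ Aτ) ^ 2 * Cd ^ 2), x₁, ?_⟩
  intro x hx M N S Rd Y hMN hNlo hNS hS14 hS12 hRd1 hRdx hYlo hYhi a₁ a₂ ha₁ ha₂ ha₁x ha₂x β hβb
    hβsf q₀ n₀ hq₀ hq₀x hn₀ hn₀x hq₀n₀ hq₀a hn₀a₂ ξ l₁ l₂
  obtain ⟨hx2, hE1, hE2, hE3, hE4, hE5⟩ := hx₁ x hx
  ----------------------------------------------------------------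
  -- basic sizes
  ----------------------------------------------------------------
  have hx1 : (1 : ℝ) ≤ x := by linarith only [hx2]
  have hx0 : (0 : ℝ) < x := by linarith only [hx2]
  have xp1 : ∀ a : ℝ, 0 ≤ a → (1 : ℝ) ≤ x ^ a := fun a ha => Real.one_le_rpow hx1 ha
  have hN1 : (1 : ℝ) ≤ N := le_trans (xp1 η hη.le) hNlo
  have hN : (0 : ℝ) < N := by linarith only [hN1]
  have hS1 : (1 : ℝ) ≤ S := le_trans (xp1 _ (by norm_num)) hS14
  have hS : (0 : ℝ) < S := by linarith only [hS1]
  have hM : (0 : ℝ) < M := by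
    by_contra hM0
    push Not at hM0
    nlinarith only [hM0, hMN, hN, hx0]
  have hY : (0 : ℝ) < Y := lt_of_lt_of_le (by positivity) hYlo
  have hSx : S ≤ x := hS12.trans (by
    calc x ^ (1 / 2 + δ) ≤ x ^ (1 : ℝ) := Real.rpow_le_rpow_of_exponent_le hx1 (by linarith only [hδκ, hκs])
      _ = x := Real.rpow_one x)
  have hNSle : N ≤ S := hNS.trans (by
    calc S ^ (2 / 3 - η) ≤ S ^ (1 : ℝ) := Real.rpow_le_rpow_of_exponent_le hS1 (by linarith only [hη])
      _ = S := Real.rpow_one S)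
  have hNx : N ≤ x := hNSle.trans hSx
  have hm : 0 < a₂.natAbs * n₀ := Nat.mul_pos (Int.natAbs_pos.2 ha₂) hn₀
  have hq₀a₁ : IsCoprime (q₀ : ℤ) a₁ := hq₀a.of_mul_right_left
  have hq₀a₂ : IsCoprime (q₀ : ℤ) a₂ := hq₀a.of_mul_right_right
  have ha₁r : (a₁.natAbs : ℝ) ≤ x ^ δ := by rw [Nat.cast_natAbs]; exact_mod_cast ha₁x
  have ha₂r : (a₂.natAbs : ℝ) ≤ x ^ δ := by rw [Nat.cast_natAbs]; exact_mod_cast ha₂x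
  have ha₁pos : (0 : ℝ) < a₁.natAbs := by exact_mod_cast Int.natAbs_pos.2 ha₁
  ----------------------------------------------------------------
  -- truncation of `β`
  ----------------------------------------------------------------
  set β' : ℕ → ℂ := fun n => if (n : ℝ) ≤ 2 * N then β n else 0 with hβ'def
  have hβ'sf : ∀ n, ¬Squarefree n → β' n = 0 := by
    intro n hn
    simp only [hβ'def]
    split_ifs
    · exact hβsf n hn
    · rfl
  set Bβ : ℝ := Cσ ^ Aτ * (2 * x) ^ (κ / 8) with hBβdef
  have hCσ0 : 0 < Cσ := by linarith only [hCσ1]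
  have hBβ0 : 0 ≤ Bβ := by positivity
  have h2x1 : (1 : ℝ) ≤ 2 * x := by linarith only [hx1]
  have hβ'b : ∀ n, ‖β' n‖ ≤ Bβ := by
    intro n
    simp only [hβ'def]
    split_ifs with hle
    · have h1 := hβb n
      have h2 := hCσ n
      have hσ0 : (0 : ℝ) ≤ ((σ 0 n : ℕ) : ℝ) := by positivity
      have hn0 : (0 : ℝ) ≤ (n : ℝ) := by positivity
      have hexp0 : 0 ≤ κ / (8 * (Aτ + 1)) := by positivity
      calc ‖β n‖ ≤ ((σ 0 n : ℕ) : ℝ) ^ Aτ := h1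
        _ ≤ (Cσ * (n : ℝ) ^ (κ / (8 * (Aτ + 1)))) ^ Aτ := Real.rpow_le_rpow hσ0 h2 hAτ
        _ = Cσ ^ Aτ * ((n : ℝ) ^ (κ / (8 * (Aτ + 1)))) ^ Aτ :=
            Real.mul_rpow hCσ0.le (Real.rpow_nonneg hn0 _)
        _ = Cσ ^ Aτ * (n : ℝ) ^ (κ / (8 * (Aτ + 1)) * Aτ) := by rw [← Real.rpow_mul hn0]
        _ ≤ Cσ ^ Aτ * (2 * x) ^ (κ / (8 * (Aτ + 1)) * Aτ) := by
            gcongr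
            exact hle.trans (by linarith only [hNx])
        _ ≤ Cσ ^ Aτ * (2 * x) ^ (κ / 8) := by
            refine mul_le_mul_of_nonneg_left (Real.rpow_le_rpow_of_exponent_le h2x1 ?_) (by positivity)
            rw [div_mul_eq_mul_div, div_le_div_iff₀ (by positivity) (by norm_num)]
            nlinarith only [hκ0.le, hAτ]
    · rw [norm_zero]; exact hBβ0
  have hLIT := R1pp_beta_congr (S := S) (Y := Y) (M := M) (a₁ := a₁) (a₂ := a₂) (q₀ := q₀)
    (n₀ := n₀) (l₁ := l₁) (l₂ := l₂) (β := β) (β' := β') (ξ := ξ)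
    (H := ⌈(3 * S) ^ 2 * x ^ ε₁ / M⌉₊) (N := N) (fun n hn => by
      have h3 := (mem_Bset hN.le hn₀ hn).2.2
      have h4 := ((BFI.mem_dyadic hN.le).1 h3).2
      simp only [hβ'def]
      rw [if_pos h4])
  rw [hLIT]
  ----------------------------------------------------------------
  -- degenerate cases
  ----------------------------------------------------------------
  have hRHS0 : 0 ≤ 169632 * Real.sqrt (9 / 5) * A * (2 * (Cσ ^ Aτ) ^ 2 * Cd ^ 2) * N ^ 2 * S ^ 2 *
      x ^ (-7 * κ) := by positivity
  by_cases hξ : ξ ≤ 0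
  · rw [R1pp_eq_zero_of_xi_nonpos hM hξ, norm_zero]; exact hRHS0
  push Not at hξ
  by_cases hcls : (l₁ < a₂.natAbs * n₀ ∧ l₂ < a₂.natAbs * n₀ ∧ Nat.Coprime l₁ (a₂.natAbs * n₀) ∧
      Nat.Coprime l₂ (a₂.natAbs * n₀))
  swap
  · rw [R1pp_eq_zero_of_bad_classes hm hcls, norm_zero]; exact hRHS0
  obtain ⟨hl₁lt, hl₂lt, hl₁, hl₂⟩ := hcls
  ----------------------------------------------------------------
  -- the decomposition into blocked pieces
  ----------------------------------------------------------------
  set H : ℕ := ⌈(3 * S) ^ 2 * x ^ ε₁ / M⌉₊ with hHdef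
  have hHr : (H : ℝ) ≤ 9 * S ^ 2 * N * x ^ ε₁ / x + 1 := by
    have h1 : (H : ℝ) < (3 * S) ^ 2 * x ^ ε₁ / M + 1 := Nat.ceil_lt_add_one (by positivity)
    have h2 : (3 * S) ^ 2 * x ^ ε₁ / M = 9 * S ^ 2 * N * x ^ ε₁ / x := by
      rw [← hMN]; field_simp; ring
    linarith only [h1, h2]
  have hYS' : Y ≤ S := by linarith only [hYhi, hS]
  have hHlt : (H : ℝ) < (S - Y) ^ 2 / q₀ := by
    -- `9 S² N x^{ε₁}/x + 1 < (3S/4)²/x^κ ≤ (S−Y)²/q₀`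
    have hq₀r : (0 : ℝ) < q₀ := by exact_mod_cast hq₀
    have hSY : 3 * S / 4 ≤ S - Y := by linarith only [hYhi]
    have h1 : (3 * S / 4) ^ 2 / x ^ κ ≤ (S - Y) ^ 2 / q₀ := by
      have hxκ : 0 < x ^ κ := by positivity
      rw [div_le_div_iff₀ hxκ hq₀r]
      have h3 : (3 * S / 4) ^ 2 ≤ (S - Y) ^ 2 := by nlinarith only [hSY, hS]
      exact mul_le_mul h3 hq₀x (by positivity) (by positivity)
    refine lt_of_le_of_lt hHr (lt_of_lt_of_le ?_ h1)
    rw [lt_div_iff₀ (by positivity)]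
    -- `N x^{ε₁+κ}·32 ≤ x` and `32 x^κ ≤ 9 S²`
    have hN7 : N ≤ x ^ (7 / 20 : ℝ) := by
      have h2 : S ^ (2 / 3 - η) ≤ S ^ (2 / 3 : ℝ) := Real.rpow_le_rpow_of_exponent_le hS1 (by linarith only [hη])
      have h3 : S ^ (2 / 3 : ℝ) ≤ (x ^ (1 / 2 + δ)) ^ (2 / 3 : ℝ) := Real.rpow_le_rpow hS.le hS12 (by norm_num)
      rw [← Real.rpow_mul hx0.le] at h3
      have h4 : x ^ ((1 / 2 + δ) * (2 / 3)) ≤ x ^ (7 / 20 : ℝ) :=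
        Real.rpow_le_rpow_of_exponent_le hx1 (by linarith only [hδκ, hκs])
      exact hNS.trans (h2.trans (h3.trans h4))
    have hA1 : 9 * S ^ 2 * N * x ^ ε₁ / x * x ^ κ ≤ 9 * S ^ 2 / 64 := by
      have e1 : 9 * S ^ 2 * N * x ^ ε₁ / x * x ^ κ = 9 * S ^ 2 * (N * x ^ ε₁ * x ^ κ) / x := by ring
      rw [e1, div_le_div_iff₀ hx0 (by norm_num)]
      have h5 : N * x ^ ε₁ * x ^ κ ≤ x ^ (7 / 20 + ε₁ + κ) := by
        rw [Real.rpow_add hx0, Real.rpow_add hx0]; gcongr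
      have h6 : 64 * (N * x ^ ε₁ * x ^ κ) ≤ x := by
        have h8 := hE2
        rw [Real.rpow_one] at h8
        calc 64 * (N * x ^ ε₁ * x ^ κ) ≤ 64 * x ^ (7 / 20 + ε₁ + κ) := by gcongr
          _ ≤ x := h8
      have h7 : (0:ℝ) ≤ 9 * S ^ 2 := by positivity
      have h9 := mul_le_mul_of_nonneg_left h6 h7
      linarith only [h9]
    have hA2 : 1 * x ^ κ ≤ 9 * S ^ 2 / 32 := by
      have h5 : x ^ (1 / 2 : ℝ) ≤ S ^ 2 := by
        have h6 : (x ^ (1 / 4 : ℝ)) ^ 2 ≤ S ^ 2 := by gcongr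
        have h7 : (x ^ (1 / 4 : ℝ)) ^ 2 = x ^ (1 / 2 : ℝ) := by
          rw [← Real.rpow_natCast, ← Real.rpow_mul hx0.le]; norm_num
        rw [← h7]; exact h6
      linarith only [hE3, h5]
    rw [add_mul]
    calc 9 * S ^ 2 * N * x ^ ε₁ / x * x ^ κ + 1 * x ^ κ ≤ 9 * S ^ 2 / 64 + 9 * S ^ 2 / 32 :=
          add_le_add hA1 hA2
      _ < (3 * S / 4) ^ 2 := by nlinarith only [hS]
  have hHW : ∀ q₁ q₂ : ℕ, BFI.bump S Y ((q₀ * q₁ : ℕ) : ℝ) ≠ 0 → BFI.bump S Y ((q₀ * q₂ : ℕ) : ℝ) ≠ 0 →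
      H < q₀ * q₁ * q₂ := fun q₁ q₂ h1 h2 => H_lt_W_of_bump_ne_zero hY hYS' hq₀ hHlt q₁ q₂ h1 h2
  have hn₀N2 : 2 * (n₀ : ℝ) ≤ N := by
    calc 2 * (n₀ : ℝ) ≤ 2 * x ^ κ := by gcongr
      _ ≤ x ^ η := hE1
      _ ≤ N := hNlo
  have hB1 := one_not_mem_Bset (a₂ := a₂) hN.le hn₀N2
  set L : ℕ := Nat.log 2 ⌊(a₁.natAbs : ℝ) * H * (2 * N)⌋₊ with hLdef
  set K : ℕ := L + 1 with hKdef
  have hy0 : 0 ≤ (a₁.natAbs : ℝ) * H * (2 * N) := by positivity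
  have hKlt : (a₁.natAbs : ℝ) * H * (2 * N) < (2 : ℝ) ^ K := by
    have h1 := Nat.lt_floor_add_one ((a₁.natAbs : ℝ) * H * (2 * N))
    have h2 : ⌊(a₁.natAbs : ℝ) * H * (2 * N)⌋₊ < 2 ^ K :=
      Nat.lt_pow_succ_log_self (by norm_num) _
    have h3 : ((⌊(a₁.natAbs : ℝ) * H * (2 * N)⌋₊ : ℕ) : ℝ) + 1 ≤ ((2 ^ K : ℕ) : ℝ) := by
      exact_mod_cast h2
    push_cast at h3
    linarith only [h1, h3]
  have hK : ∀ n₁ ∈ ((((BFI.dyadic N).filter (fun n : ℕ => IsCoprime (n : ℤ) a₂)).filter (fun n : ℕ => n₀ ∣ n)).image (fun n : ℕ => n / n₀)), ∀ n₂ ∈ ((((BFI.dyadic N).filter (fun n : ℕ => IsCoprime (n : ℤ) a₂)).filter (fun n : ℕ => n₀ ∣ n)).image (fun n : ℕ => n / n₀)), ∀ h ∈ Finset.Icc (-(H : ℤ)) H,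
      (a₁ * h * (((n₁ : ℤ) - n₂) / q₀)).natAbs < 2 ^ K :=
    fun n₁ hn₁ n₂ hn₂ h hh => natAbs_rough_lt hN.le hKlt hn₁ hn₂ hh
  refine (norm_R1pp_le_sum_blocks (M := M) ha₁ ha₂ hq₀ hq₀a₁ l₁ l₂ β' ξ H hHW hB1 hK).trans ?_
  ----------------------------------------------------------------
  -- each block: `≤ 4F`
  ----------------------------------------------------------------
  have h2K : ((2 ^ K : ℕ) : ℝ) ≤ 4 * x ^ δ * H * N + 2 := by
    -- `2^K = 2·2^{log₂ n} ≤ 2 (n + 1)`, `n ≤ |a₁| H 2N ≤ x^δ H 2N`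
    have h1 : ((2 ^ L : ℕ) : ℝ) ≤ (a₁.natAbs : ℝ) * H * (2 * N) + 1 := by
      rcases Nat.eq_zero_or_pos ⌊(a₁.natAbs : ℝ) * H * (2 * N)⌋₊ with h0 | hpos
      · have : L = 0 := by rw [hLdef, h0]; simp
        rw [this]; push_cast; linarith only [hy0]
      · have h2 : 2 ^ L ≤ ⌊(a₁.natAbs : ℝ) * H * (2 * N)⌋₊ := by
          rw [hLdef]; exact Nat.pow_log_le_self 2 hpos.ne'
        have h3 : ((2 ^ L : ℕ) : ℝ) ≤ ((⌊(a₁.natAbs : ℝ) * H * (2 * N)⌋₊ : ℕ) : ℝ) := by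
          exact_mod_cast h2
        linarith only [h3, Nat.floor_le hy0]
    have h4 : ((2 ^ K : ℕ) : ℝ) = 2 * ((2 ^ L : ℕ) : ℝ) := by
      rw [hKdef, pow_succ]; push_cast; ring
    rw [h4]
    have h5 : (a₁.natAbs : ℝ) * H * (2 * N) ≤ x ^ δ * H * (2 * N) := by gcongr
    linarith only [h1, h5]
  have hΛall : ∀ δ₁ δ₂ : ℕ, 0 < δ₁ → 0 < δ₂ → δ₁ ≤ a₁.natAbs → δ₂ ≤ a₁.natAbs →
      ∀ t : ℝ, (S - Y) / ((q₀ : ℝ) * ((δ₁ : ℝ) * δ₂)) ≤ t →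
        (2 * S + Y) / Y + 29 + 3 ≤ 64 * t ^ (8 * δ) := by
    intro δ₁ δ₂ hδ₁ hδ₂ hδ₁a hδ₂a
    refine absorption64 hx1 hδ0.le hκ0.le (by linarith only [hκs, hδκ, hκ0]) hS14 hYlo hYhi hY (by positivity) ?_
    have h1 : (δ₁ : ℝ) ≤ x ^ δ := le_trans (by exact_mod_cast hδ₁a) ha₁r
    have h2 : (δ₂ : ℝ) ≤ x ^ δ := le_trans (by exact_mod_cast hδ₂a) ha₁r
    gcongr
  have hq : ((a₂.natAbs * n₀ : ℕ) : ℝ) ≤ x ^ (δ + κ) := by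
    push_cast; rw [Real.rpow_add hx0]; gcongr
  have hn₀N : (n₀ : ℝ) ≤ N := by linarith only [hn₀N2, show (0:ℝ) ≤ n₀ by positivity]
  have hNS' : N ≤ S ^ (2 / 3 - η') := hNS.trans (Real.rpow_le_rpow_of_exponent_le hS1 (by linarith only [hη'η]))
  have hexp : 7 / 2 * (κ + Bc * (8 * δ)) + 15 / 2 * δ + 21 / 2 * κ + ε₁ ≤ min (3 * η' / 4) (1 / 6) / 2 := by
    rw [← hνdef]; linarith only [hBδ, hδκ, hε₁κ, hκdef, hκ0]
  have he0 : 0 ≤ κ + Bc * (8 * δ) := by positivity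
  have he1 : κ + Bc * (8 * δ) ≤ 1 := by linarith only [hBδ, hκs]
  have hC1all : ∀ δ' : ℕ, 0 < δ' → δ' ≤ a₁.natAbs → (1 : ℝ) ≤ 29 / 40 * S / ((q₀ : ℝ) * δ') := by
    intro δ' hδ' hδ'a
    have h1 : (δ' : ℝ) ≤ x ^ δ := le_trans (by exact_mod_cast hδ'a) ha₁r
    have hpos : (0 : ℝ) < (q₀ : ℝ) * δ' := by positivity
    rw [le_div_iff₀ hpos, one_mul]
    have h2 : (q₀ : ℝ) * δ' ≤ x ^ κ * x ^ δ := by gcongr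
    have h3 : x ^ κ * x ^ δ = x ^ (κ + δ) := by rw [← Real.rpow_add hx0]
    linarith only [hE4, h2, h3, hS14]
  have hterm : ∀ δ₁ ∈ ((a₁.natAbs.divisors).filter (fun δ : ℕ => Nat.Coprime δ (a₂.natAbs * n₀))), ∀ δ₂ ∈ ((a₁.natAbs.divisors).filter (fun δ : ℕ => Nat.Coprime δ (a₂.natAbs * n₀))), ∀ p ∈ ({1, -1} : Finset ℤ) ×ˢ Finset.range K,
      (‖pieceSumBlk a₁ a₂ (((((((BFI.mRange S Y).filter (fun q : ℕ => 0 < q)).filter (fun q : ℕ => IsCoprime (q : ℤ) a₂)).filter (fun q : ℕ => q₀ ∣ q)).image (fun q : ℕ => q / q₀)).filter (fun q : ℕ => q % (a₂.natAbs * n₀) = l₁)).filter (fun q : ℕ => δ₁ ∣ q))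
            (((((((BFI.mRange S Y).filter (fun q : ℕ => 0 < q)).filter (fun q : ℕ => IsCoprime (q : ℤ) a₂)).filter (fun q : ℕ => q₀ ∣ q)).image (fun q : ℕ => q / q₀)).filter (fun q : ℕ => q % (a₂.natAbs * n₀) = l₂)).filter (fun q : ℕ => δ₂ ∣ q)) ((((BFI.dyadic N).filter (fun n : ℕ => IsCoprime (n : ℤ) a₂)).filter (fun n : ℕ => n₀ ∣ n)).image (fun n : ℕ => n / n₀))
            q₀ n₀ l₁ l₂ β' ξ (fun q₁ q₂ : ℕ => pieceLo S Y q₀ q₁ * pieceLo S Y q₀ q₂ *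
          alphaProfile ((q₀ : ℝ) * ξ / M * q₁ * q₂)) H p.1 (2 ^ p.2) (2 ^ (p.2 + 1))‖ +
          ‖pieceSumBlk a₁ a₂ (((((((BFI.mRange S Y).filter (fun q : ℕ => 0 < q)).filter (fun q : ℕ => IsCoprime (q : ℤ) a₂)).filter (fun q : ℕ => q₀ ∣ q)).image (fun q : ℕ => q / q₀)).filter (fun q : ℕ => q % (a₂.natAbs * n₀) = l₁)).filter (fun q : ℕ => δ₁ ∣ q))
            (((((((BFI.mRange S Y).filter (fun q : ℕ => 0 < q)).filter (fun q : ℕ => IsCoprime (q : ℤ) a₂)).filter (fun q : ℕ => q₀ ∣ q)).image (fun q : ℕ => q / q₀)).filter (fun q : ℕ => q % (a₂.natAbs * n₀) = l₂)).filter (fun q : ℕ => δ₂ ∣ q)) ((((BFI.dyadic N).filter (fun n : ℕ => IsCoprime (n : ℤ) a₂)).filter (fun n : ℕ => n₀ ∣ n)).image (fun n : ℕ => n / n₀))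
            q₀ n₀ l₁ l₂ β' ξ (fun q₁ q₂ : ℕ => pieceLo S Y q₀ q₁ * pieceHi S Y q₀ q₂ *
          alphaProfile ((q₀ : ℝ) * ξ / M * q₁ * q₂)) H p.1 (2 ^ p.2) (2 ^ (p.2 + 1))‖ +
          ‖pieceSumBlk a₁ a₂ (((((((BFI.mRange S Y).filter (fun q : ℕ => 0 < q)).filter (fun q : ℕ => IsCoprime (q : ℤ) a₂)).filter (fun q : ℕ => q₀ ∣ q)).image (fun q : ℕ => q / q₀)).filter (fun q : ℕ => q % (a₂.natAbs * n₀) = l₁)).filter (fun q : ℕ => δ₁ ∣ q))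
            (((((((BFI.mRange S Y).filter (fun q : ℕ => 0 < q)).filter (fun q : ℕ => IsCoprime (q : ℤ) a₂)).filter (fun q : ℕ => q₀ ∣ q)).image (fun q : ℕ => q / q₀)).filter (fun q : ℕ => q % (a₂.natAbs * n₀) = l₂)).filter (fun q : ℕ => δ₂ ∣ q)) ((((BFI.dyadic N).filter (fun n : ℕ => IsCoprime (n : ℤ) a₂)).filter (fun n : ℕ => n₀ ∣ n)).image (fun n : ℕ => n / n₀))
            q₀ n₀ l₁ l₂ β' ξ (fun q₁ q₂ : ℕ => pieceHi S Y q₀ q₁ * pieceLo S Y q₀ q₂ *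
          alphaProfile ((q₀ : ℝ) * ξ / M * q₁ * q₂)) H p.1 (2 ^ p.2) (2 ^ (p.2 + 1))‖ +
          ‖pieceSumBlk a₁ a₂ (((((((BFI.mRange S Y).filter (fun q : ℕ => 0 < q)).filter (fun q : ℕ => IsCoprime (q : ℤ) a₂)).filter (fun q : ℕ => q₀ ∣ q)).image (fun q : ℕ => q / q₀)).filter (fun q : ℕ => q % (a₂.natAbs * n₀) = l₁)).filter (fun q : ℕ => δ₁ ∣ q))
            (((((((BFI.mRange S Y).filter (fun q : ℕ => 0 < q)).filter (fun q : ℕ => IsCoprime (q : ℤ) a₂)).filter (fun q : ℕ => q₀ ∣ q)).image (fun q : ℕ => q / q₀)).filter (fun q : ℕ => q % (a₂.natAbs * n₀) = l₂)).filter (fun q : ℕ => δ₂ ∣ q)) ((((BFI.dyadic N).filter (fun n : ℕ => IsCoprime (n : ℤ) a₂)).filter (fun n : ℕ => n₀ ∣ n)).image (fun n : ℕ => n / n₀))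
            q₀ n₀ l₁ l₂ β' ξ (fun q₁ q₂ : ℕ => pieceHi S Y q₀ q₁ * pieceHi S Y q₀ q₂ *
          alphaProfile ((q₀ : ℝ) * ξ / M * q₁ * q₂)) H p.1 (2 ^ p.2) (2 ^ (p.2 + 1))‖) ≤ 4 * (169632 * A * (Real.sqrt (9 / 5) * Bβ ^ 2) * N ^ 2 * S ^ 2 * x ^ (-8 * κ)) := by
    intro δ₁ hδ₁D δ₂ hδ₂D p hp
    rw [Finset.mem_filter, Nat.mem_divisors] at hδ₁D hδ₂D
    obtain ⟨⟨hδ₁dvd, _⟩, hδ₁m⟩ := hδ₁D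
    obtain ⟨⟨hδ₂dvd, _⟩, hδ₂m⟩ := hδ₂D
    have ha₁0 : a₁.natAbs ≠ 0 := Int.natAbs_ne_zero.2 ha₁
    have hδ₁ : 0 < δ₁ := Nat.pos_of_ne_zero fun h => by rw [h, zero_dvd_iff] at hδ₁dvd; exact ha₁0 hδ₁dvd
    have hδ₂ : 0 < δ₂ := Nat.pos_of_ne_zero fun h => by rw [h, zero_dvd_iff] at hδ₂dvd; exact ha₁0 hδ₂dvd
    have hδ₁a : δ₁ ≤ a₁.natAbs := Nat.le_of_dvd (Nat.pos_of_ne_zero ha₁0) hδ₁dvd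
    have hδ₂a : δ₂ ≤ a₁.natAbs := Nat.le_of_dvd (Nat.pos_of_ne_zero ha₁0) hδ₂dvd
    have hδ₁x : (δ₁ : ℝ) ≤ x ^ δ := le_trans (by exact_mod_cast hδ₁a) ha₁r
    have hδ₂x : (δ₂ : ℝ) ≤ x ^ δ := le_trans (by exact_mod_cast hδ₂a) ha₁r
    obtain ⟨sg, k⟩ := p
    simp only [Finset.mem_product, Finset.mem_insert, Finset.mem_singleton, Finset.mem_range] at hp
    obtain ⟨hσ, hkK⟩ := hp
    have hk : ((2 ^ (k + 1) : ℕ) : ℝ) ≤ 4 * x ^ δ * H * N + 2 := by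
      have h1 : 2 ^ (k + 1) ≤ 2 ^ K := Nat.pow_le_pow_right (by norm_num) hkK
      have h2 : ((2 ^ (k + 1) : ℕ) : ℝ) ≤ ((2 ^ K : ℕ) : ℝ) := by exact_mod_cast h1
      exact h2.trans h2K
    dsimp only
    rcases hσ with rfl | rfl
    · exact four_blocks_le_pos hx1 hη'0 hη'1 hδ0.le hκ0.le hε₁0.le he0 he1 rfl
        (by linarith only [hδκ, hκs, hκ0]) (by linarith only [hκs]) (by linarith only [hε₁κ, hκs]) hexp hS14 hS12 hN1 hNS' hY hYhi hM.le hξ.le ha₂ hq₀ hn₀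
        hq₀n₀ hq₀a₂ hl₁ hl₂ hl₁lt hl₂lt hδ₁ hδ₂ hδ₁m hδ₂m hδ₁x hδ₂x ha₂r hq hn₀N hβ'sf hBβ0 hβ'b H k
        hHr hk (hC1all δ₂ hδ₂ hδ₂a) (hC1all δ₁ hδ₁ hδ₁a) (by positivity) (by linarith) (by norm_num)
        (hΛall δ₁ δ₂ hδ₁ hδ₂ hδ₁a hδ₂a) hA.le hcrux
    · exact four_blocks_le_neg hx1 hη'0 hη'1 hδ0.le hκ0.le hε₁0.le he0 he1 rfl
        (by linarith only [hδκ, hκs, hκ0]) (by linarith only [hκs]) (by linarith only [hε₁κ, hκs]) hexp hS14 hS12 hN1 hNS' hY hYhi hM.le hξ.le ha₂ hq₀ hn₀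
        hq₀n₀ hq₀a₂ hl₁ hl₂ hl₁lt hl₂lt hδ₁ hδ₂ hδ₁m hδ₂m hδ₁x hδ₂x ha₂r hq hn₀N hβ'sf hBβ0 hβ'b H k
        hHr hk (hC1all δ₂ hδ₂ hδ₂a) (hC1all δ₁ hδ₁ hδ₁a) (by positivity) (by linarith) (by norm_num)
        (hΛall δ₁ δ₂ hδ₁ hδ₂ hδ₁a hδ₂a) hA.le hcrux
  refine (Finset.sum_le_sum fun δ₁ hδ₁ => Finset.sum_le_sum fun δ₂ hδ₂ =>
    Finset.sum_le_sum fun p hp => hterm δ₁ hδ₁ δ₂ hδ₂ p hp).trans ?_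
  ----------------------------------------------------------------
  -- counting
  ----------------------------------------------------------------
  rw [Finset.sum_const, Finset.sum_const, Finset.sum_const, nsmul_eq_mul, nsmul_eq_mul, nsmul_eq_mul]
  have hP : ((({1, -1} : Finset ℤ) ×ˢ Finset.range K).card : ℝ) = 2 * K := by
    rw [Finset.card_product, Finset.card_range, Finset.card_insert_of_notMem (by decide),
      Finset.card_singleton]
    push_cast; ring
  rw [hP]
  -- `#D ≤ Cd x^{δ/8}`
  have hD : ((((a₁.natAbs.divisors).filter (fun δ : ℕ => Nat.Coprime δ (a₂.natAbs * n₀)))).card : ℝ) ≤ Cd * x ^ (δ / 8) := by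
    have h1 : (((a₁.natAbs.divisors).filter (fun δ : ℕ => Nat.Coprime δ (a₂.natAbs * n₀)))).card ≤ (a₁.natAbs.divisors).card := Finset.card_filter_le _ _
    have h2 : (((((a₁.natAbs.divisors).filter (fun δ : ℕ => Nat.Coprime δ (a₂.natAbs * n₀)))).card : ℕ) : ℝ) ≤ ((a₁.natAbs.divisors).card : ℝ) := by exact_mod_cast h1
    refine h2.trans ((hCd _ (Int.natAbs_ne_zero.2 ha₁)).trans ?_)
    gcongr
    calc (a₁.natAbs : ℝ) ^ (1 / 8 : ℝ) ≤ (x ^ δ) ^ (1 / 8 : ℝ) :=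
          Real.rpow_le_rpow (by positivity) ha₁r (by norm_num)
      _ = x ^ (δ / 8) := by rw [← Real.rpow_mul hx0.le]; ring_nf
  -- `8K ≤ 48 log x + 312 ≤ x^{κ/4}`
  have hKb : 8 * (K : ℝ) ≤ x ^ (κ / 4) := by
    refine le_trans ?_ hE5
    -- `K - 1 ≤ 2 log(20 x³)`-type bound
    have hlog2 : (1 : ℝ) / 2 ≤ Real.log 2 := by
      have := Real.one_sub_inv_le_log_of_pos (by norm_num : (0 : ℝ) < 2)
      norm_num at this; linarith only [this]
    have hy : (a₁.natAbs : ℝ) * H * (2 * N) ≤ 20 * x ^ (3 : ℝ) := by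
      have hS2 : S ^ 2 ≤ x ^ (1 + 2 * δ) := by
        have := Real.rpow_le_rpow hS.le hS12 (by norm_num : (0 : ℝ) ≤ 2)
        rw [← Real.rpow_mul hx0.le, show ((1 / 2 + δ) * 2 : ℝ) = 1 + 2 * δ by ring] at this
        calc S ^ 2 = S ^ (2 : ℝ) := by rw [← Real.rpow_natCast]; norm_num
          _ ≤ _ := this
      have hH' : (H : ℝ) ≤ 10 * x ^ (1 + 2 * δ + ε₁) := by
        have h1 : 9 * S ^ 2 * N * x ^ ε₁ / x ≤ 9 * x ^ (1 + 2 * δ + ε₁) := by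
          rw [div_le_iff₀ hx0, Real.rpow_add hx0]
          have : 9 * S ^ 2 * N * x ^ ε₁ = 9 * (S ^ 2 * x ^ ε₁) * N := by ring
          rw [this]
          have h2 : 9 * (S ^ 2 * x ^ ε₁) * N ≤ 9 * (x ^ (1 + 2 * δ) * x ^ ε₁) * x := by gcongr
          linarith only [h2]
        have h3 : (1 : ℝ) ≤ x ^ (1 + 2 * δ + ε₁) := xp1 _ (by positivity)
        linarith only [hHr, h1, h3]
      calc (a₁.natAbs : ℝ) * H * (2 * N) ≤ x ^ δ * (10 * x ^ (1 + 2 * δ + ε₁)) * (2 * x) := by gcongr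
        _ = 20 * (x ^ δ * x ^ (1 + 2 * δ + ε₁) * x ^ (1 : ℝ)) := by rw [Real.rpow_one]; ring
        _ = 20 * x ^ (δ + (1 + 2 * δ + ε₁) + 1) := by rw [← Real.rpow_add hx0, ← Real.rpow_add hx0]
        _ ≤ 20 * x ^ (3 : ℝ) := by
            gcongr 20 * ?_
            exact Real.rpow_le_rpow_of_exponent_le hx1 (by linarith only [hδκ, hκs, hε₁κ, hκ0])
    have hL1 : (L : ℝ) ≤ 2 * (Real.log 20 + 3 * Real.log x) := by
      have hlx := Real.log_nonneg hx1
      have h20 : (0:ℝ) ≤ Real.log 20 := Real.log_nonneg (by norm_num)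
      rcases Nat.eq_zero_or_pos ⌊(a₁.natAbs : ℝ) * H * (2 * N)⌋₊ with h0 | hpos
      · have : L = 0 := by rw [hLdef, h0]; simp
        rw [this]; push_cast
        linarith only [hlx, h20]
      · have h2 : 2 ^ L ≤ ⌊(a₁.natAbs : ℝ) * H * (2 * N)⌋₊ := by
          rw [hLdef]; exact Nat.pow_log_le_self 2 hpos.ne'
        have h3 : ((2 : ℝ)) ^ L ≤ (a₁.natAbs : ℝ) * H * (2 * N) := by
          have : ((2 ^ L : ℕ) : ℝ) ≤ ((⌊(a₁.natAbs : ℝ) * H * (2 * N)⌋₊ : ℕ) : ℝ) := by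
            exact_mod_cast h2
          push_cast at this
          exact this.trans (Nat.floor_le hy0)
        have h4 : (L : ℝ) * Real.log 2 ≤ Real.log (20 * x ^ (3 : ℝ)) := by
          rw [← Real.log_pow]
          exact Real.log_le_log (by positivity) (h3.trans hy)
        have h5 : Real.log (20 * x ^ (3 : ℝ)) = Real.log 20 + 3 * Real.log x := by
          rw [Real.log_mul (by norm_num) (by positivity), Real.log_rpow hx0]
        rw [h5] at h4
        have h7 := mul_le_mul_of_nonneg_left hlog2 (Nat.cast_nonneg L : (0 : ℝ) ≤ (L : ℝ))
        linarith only [h4, h7]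
    have hlog20 : Real.log 20 ≤ 19 := by
      have := Real.log_le_sub_one_of_pos (by norm_num : (0 : ℝ) < 20); linarith only [this]
    have hKr : (K : ℝ) = (L : ℝ) + 1 := by rw [hKdef]; push_cast; ring
    rw [hKr]
    linarith only [hL1, hlog20, Real.log_nonneg hx1]
  -- `Bβ² ≤ 2 (Cσ^Aτ)² x^{κ/4}`
  have hBβ2 : Bβ ^ 2 ≤ 2 * (Cσ ^ Aτ) ^ 2 * x ^ (κ / 4) := by
    rw [hBβdef, mul_pow]
    have h1 : ((2 * x) ^ (κ / 8)) ^ 2 = (2 : ℝ) ^ (κ / 4) * x ^ (κ / 4) := by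
      rw [← Real.rpow_natCast, ← Real.rpow_mul (by positivity), Real.mul_rpow (by norm_num) hx0.le]
      norm_num; ring_nf
    have h2 : (2 : ℝ) ^ (κ / 4) ≤ 2 := by
      calc (2 : ℝ) ^ (κ / 4) ≤ (2 : ℝ) ^ (1 : ℝ) :=
            Real.rpow_le_rpow_of_exponent_le (by norm_num) (by linarith only [hκs, hκ0])
        _ = 2 := Real.rpow_one 2
    rw [h1]
    have h3 : 0 ≤ (Cσ ^ Aτ) ^ 2 * x ^ (κ / 4) := by positivity
    have h4 := mul_le_mul_of_nonneg_left h2 h3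
    linarith only [h4]
  -- assemble
  have hD2 : ((((a₁.natAbs.divisors).filter (fun δ : ℕ => Nat.Coprime δ (a₂.natAbs * n₀)))).card : ℝ) * ((((a₁.natAbs.divisors).filter (fun δ : ℕ => Nat.Coprime δ (a₂.natAbs * n₀)))).card : ℝ) ≤ Cd ^ 2 * x ^ (κ / 4) := by
    have h1 : ((((a₁.natAbs.divisors).filter (fun δ : ℕ => Nat.Coprime δ (a₂.natAbs * n₀)))).card : ℝ) * ((((a₁.natAbs.divisors).filter (fun δ : ℕ => Nat.Coprime δ (a₂.natAbs * n₀)))).card : ℝ) ≤ (Cd * x ^ (δ / 8)) * (Cd * x ^ (δ / 8)) :=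
      mul_le_mul hD hD (by positivity) (by positivity)
    have h2 : (Cd * x ^ (δ / 8)) * (Cd * x ^ (δ / 8)) = Cd ^ 2 * x ^ (δ / 4) := by
      rw [show Cd ^ 2 * x ^ (δ / 4) = Cd ^ 2 * (x ^ (δ / 8) * x ^ (δ / 8)) by
        rw [← Real.rpow_add hx0]; ring_nf]; ring
    have h3 : x ^ (δ / 4) ≤ x ^ (κ / 4) := Real.rpow_le_rpow_of_exponent_le hx1 (by linarith only [hδκ, hκ0])
    calc _ ≤ Cd ^ 2 * x ^ (δ / 4) := h2 ▸ h1
      _ ≤ Cd ^ 2 * x ^ (κ / 4) := by gcongr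
  have hx34 : x ^ (κ / 4) * x ^ (κ / 4) * x ^ (κ / 4) * x ^ (-8 * κ) ≤ x ^ (-7 * κ) := by
    rw [← Real.rpow_add hx0, ← Real.rpow_add hx0, ← Real.rpow_add hx0]
    exact Real.rpow_le_rpow_of_exponent_le hx1 (by linarith only [hκ0])
  -- the product
  have hF0 : 0 ≤ 169632 * A * N ^ 2 * S ^ 2 := by positivity
  calc ((((a₁.natAbs.divisors).filter (fun δ : ℕ => Nat.Coprime δ (a₂.natAbs * n₀)))).card : ℝ) * (((((a₁.natAbs.divisors).filter (fun δ : ℕ => Nat.Coprime δ (a₂.natAbs * n₀)))).card : ℝ) * (2 * (K : ℝ) * (4 * (169632 * A * (Real.sqrt (9 / 5) * Bβ ^ 2) * N ^ 2 * S ^ 2 * x ^ (-8 * κ)))))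
      = (((((a₁.natAbs.divisors).filter (fun δ : ℕ => Nat.Coprime δ (a₂.natAbs * n₀)))).card : ℝ) * ((((a₁.natAbs.divisors).filter (fun δ : ℕ => Nat.Coprime δ (a₂.natAbs * n₀)))).card : ℝ)) * (8 * (K : ℝ)) * Bβ ^ 2 *
          (169632 * Real.sqrt (9 / 5) * A * N ^ 2 * S ^ 2 * x ^ (-8 * κ)) := by ring
    _ ≤ (Cd ^ 2 * x ^ (κ / 4)) * x ^ (κ / 4) * (2 * (Cσ ^ Aτ) ^ 2 * x ^ (κ / 4)) *
          (169632 * Real.sqrt (9 / 5) * A * N ^ 2 * S ^ 2 * x ^ (-8 * κ)) := by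
        gcongr
    _ = 169632 * Real.sqrt (9 / 5) * A * (2 * (Cσ ^ Aτ) ^ 2 * Cd ^ 2) * N ^ 2 * S ^ 2 *
          (x ^ (κ / 4) * x ^ (κ / 4) * x ^ (κ / 4) * x ^ (-8 * κ)) := by ring
    _ ≤ 169632 * Real.sqrt (9 / 5) * A * (2 * (Cσ ^ Aτ) ^ 2 * Cd ^ 2) * N ^ 2 * S ^ 2 *
          x ^ (-7 * κ) := by gcongr

/-- **Theorem 5.1 of [Drappeau2017] from Theorem 2.1** (= [AssingBlomerLi2020, Theorem 2.3],
`a = 1`, taken as the hypothesis `HX`): the whole of §5 formalised.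
[cite: Drappeau2017, Theorem 5.1, §5] -/
theorem _root_.Literature.NumberTheory.Sieve.Drappeau2017_theorem51_of_ABL23
    (HX :   ∃ B : ℝ, 0 < B ∧ ∃ ε₀max : ℝ, 0 < ε₀max ∧ ∀ ε : ℝ, 0 < ε → ∀ ε₀ : ℝ, 0 < ε₀ → ε₀ ≤ ε₀max →
  ∀ Kν : (Fin 5 → ℕ) → ℝ, ∃ A : ℝ, 0 < A ∧
  ∀ C D N R S : ℝ, 1 ≤ C → 1 ≤ D → 1 ≤ N → 1 ≤ R → 1 ≤ S →
  ∀ q c₀ d₀ : ℕ, 0 < q → Nat.Coprime (c₀ * d₀) q →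
  ∀ b : ℕ → ℕ → ℕ → ℂ,
    (∀ n r s : ℕ, b n r s ≠ 0 →
      (0 < n ∧ (n : ℝ) ≤ N ∧ R < r ∧ (r : ℝ) ≤ 2 * R ∧ S < s ∧ (s : ℝ) ≤ 2 * S)) →
  ∀ g : ℝ → ℝ → ℝ → ℝ → ℝ → ℂ,
    ContDiff ℝ (⊤ : ℕ∞) (fun p : Fin 5 → ℝ => g (p 0) (p 1) (p 2) (p 3) (p 4)) →
    HasCompactSupport (fun p : Fin 5 → ℝ => g (p 0) (p 1) (p 2) (p 3) (p 4)) →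
    (∀ c d n r s : ℝ, g c d n r s ≠ 0 →
      (C < c ∧ c ≤ 2 * C ∧ D < d ∧ d ≤ 2 * D ∧ 0 < n ∧ 0 < r ∧ 0 < s)) →
    (∀ ν : Fin 5 → ℕ, ∀ c d n r s : ℝ, 0 < c → 0 < d → 0 < n → 0 < r → 0 < s →
      ‖mixedDeriv ν g c d n r s‖ ≤ Kν ν *
        (c ^ (-(ν 0 : ℝ)) * d ^ (-(ν 1 : ℝ)) * n ^ (-(ν 2 : ℝ)) * r ^ (-(ν 3 : ℝ)) *
          s ^ (-(ν 4 : ℝ))) ^ (1 - ε₀)) →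
    ‖∑ c ∈ Icc 1 ⌊2 * C⌋₊, ∑ d ∈ Icc 1 ⌊2 * D⌋₊, ∑ n ∈ Icc 1 ⌊N⌋₊, ∑ r ∈ Icc 1 ⌊2 * R⌋₊,
        ∑ s ∈ Icc 1 ⌊2 * S⌋₊,
        (if (c ≡ c₀ [MOD q] ∧ d ≡ d₀ [MOD q] ∧ Nat.Coprime (q * r * d) (s * c)) then
          b n r s * g c d n r s *
            (𝐞 ((n : ℝ) * ((((r * d : ℕ) : ZMod (s * c))⁻¹).val : ℝ) / ((s : ℝ) * c)) : ℂ)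
        else 0)‖ ≤
      A * ((q : ℝ) * C * D * N * R * S) ^ (ε + B * ε₀) * (q : ℝ) ^ (3 / 2 : ℝ) *
        Real.sqrt
          ((q : ℝ) ^ 2 * (C * S * (R * S + N) * (C + R * D) + S * N * R) *
              (∑ n ∈ Icc 1 ⌊N⌋₊, ∑ r ∈ Icc 1 ⌊2 * R⌋₊, ∑ s ∈ Icc 1 ⌊2 * S⌋₊, ‖b n r s‖ ^ 2) +
            (q : ℝ) * (C ^ 2 * D * S * Real.sqrt (R * (R * S + N)) + D ^ 2 * N * R) *
              (∑ n ∈ Icc 1 ⌊N⌋₊, ∑ r ∈ Icc 1 ⌊2 * R⌋₊, ∑ s ∈ Icc 1 ⌊2 * S⌋₊, ‖b n r s‖ ^ 2))) :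
    Drappeau2017_theorem51 :=
  Drappeau2017_theorem51_of_R1pp' (R1pp_of_ABL23 HX)

end Drappeau2017

end Literature.NumberTheory.Sieve

end
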